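import Summits.CriticalPhenomena.PercolationContinuityZ3.Theorems.PercBoundarySqueezeFreeBoxSqueeze
import Summits.CriticalPhenomena.PercolationContinuityZ3.Theorems.PercBoundarySqueezeBoundaryArmCount

/-!
# Route `PercBoundarySqueeze` — `Assembly` (item stmt-CriticalPhenomena-6986)

`HalfSpaceOneArmRate → FreeBoxFatClusterMass → PercolationContinuityZ3`, i.e. the two rate
statements at `p_c(ℤ³)`

* Q1 `HalfSpaceOneArmRate`: `P(∃ y, ‖y‖_∞ ≥ r ∧ 0 ↔ y inside ℍ) ≤ C₁ r^{-b}` for `r ≥ 1`, some `b > 1/2`;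
* Q2 `FreeBoxFatClusterMass`: `Σ_{x ∈ Λ_R} P(|C_{Λ_R}(x)| ≥ ⌊√(R³)⌋) ≤ C₂ R^{3-δ}` for `R ≥ 1`, some `δ > 0`,

imply `θ(p_c) = 0` on `ℤ³`, via the two landed supports of the route:

* `freeBoxSqueeze_proof` (`FreeBoxSqueeze`, item 6984):
  `θ(p_c)·|Λ_{⌊R/2⌋}| ≤ n · Σ_{v ∈ ∂ⁱⁿΛ_R} P(v ↔ Λ_{⌊R/2⌋} in Λ_R) + Σ_{x ∈ Λ_{⌊R/2⌋}} P(|C_{Λ_R}(x)| ≥ n)`;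
* `boundaryArmCount_proof` (`BoundaryArmCount`, item 6985):
  `Σ_{v ∈ ∂ⁱⁿΛ_R} P(v ↔ Λ_{⌊R/2⌋} in Λ_R) ≤ 6(2R+1)² · P(∃ y, (∃ i, ⌊R/2⌋ ≤ |y_i|) ∧ 0 ↔ y in ℍ)`.

## Proof (real arithmetic, Zhang 2000 / Grimmett 1999 §7.2 bookkeeping)

Fix `R ≥ 2`, put `n = Nat.sqrt (R³)` (so `1 ≤ n ≤ R^{3/2}`) and `r = ⌊R/2⌋ ≥ 1`. Then
`|Λ_{⌊R/2⌋}| = (2⌊R/2⌋+1)³ ≥ R³`, `6(2R+1)² ≤ 54 R²`, `⌊R/2⌋ ≥ R/3` so `⌊R/2⌋^{-b} ≤ 3^b R^{-b}`,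
and the sum over the core `Λ_{⌊R/2⌋}` in the second term is at most the sum over `Λ_R`, which is
exactly Q2's left-hand side. Chaining,

`θ R³ ≤ R^{3/2} · 54 R² · C₁ 3^b R^{-b} + C₂ R^{3-δ} = (54·3^b·C₁·R^{1/2-b} + C₂ R^{-δ}) · R³`,

so `0 ≤ θ ≤ 54·3^b·C₁·R^{1/2-b} + C₂ R^{-δ} → 0` as `R → ∞` (`b > 1/2`, `δ > 0`), whence `θ = 0`.
-/

noncomputable section

namespace Summit.CriticalPhenomena.PercolationContinuityZ3.Theorems

open Filter Topology MeasureTheory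
open Literature.Probability.Percolation Literature.Probability.LatticeModels
open Summit.CriticalPhenomena.PercolationContinuityZ3.Theses.PercBoundarySqueeze

namespace PercBoundarySqueezeAssembly

/-- **Exponent bookkeeping**: for `R > 0`, `R^{3/2} · R² · R^{-b} = R^{1/2-b} · R³`. -/
theorem rpow_bookkeeping {R : ℝ} (hR : 0 < R) (b : ℝ) :
    R ^ ((3 : ℝ) / 2) * R ^ 2 * R ^ (-b) = R ^ ((1 : ℝ) / 2 - b) * R ^ 3 := by
  rw [← Real.rpow_natCast R 2, ← Real.rpow_natCast R 3, ← Real.rpow_add hR, ← Real.rpow_add hR,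
    ← Real.rpow_add hR]
  congr 1
  push_cast
  ring

/-- `R^{3-δ} = R^{-δ} · R³` for `R > 0`. -/
theorem rpow_three_sub {R : ℝ} (hR : 0 < R) (δ : ℝ) :
    R ^ ((3 : ℝ) - δ) = R ^ (-δ) * R ^ 3 := by
  rw [← Real.rpow_natCast R 3, ← Real.rpow_add hR]
  congr 1
  push_cast
  ring

/-- **The abstract chaining step** (pure ordered-field bookkeeping): from
`θ·V ≤ n·S + Bc`, `Rc ≤ V`, `S ≤ F·A`, `A ≤ C₁·rb`, `Bc ≤ Bb ≤ BU` and the upper bounds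
`n ≤ nU`, `F ≤ FU`, `rb ≤ rbU` (all quantities nonnegative where needed),
`θ·Rc ≤ nU·FU·(C₁·rbU) + BU`. -/
theorem chain {θ V Rc n S A F Bc Bb BU C₁ rb nU FU rbU : ℝ}
    (hθ : 0 ≤ θ) (hV : Rc ≤ V) (hFS : θ * V ≤ n * S + Bc)
    (hS : S ≤ F * A) (hA : A ≤ C₁ * rb) (hBc : Bc ≤ Bb) (hBb : Bb ≤ BU)
    (hn : n ≤ nU) (hF : F ≤ FU) (hrb : rb ≤ rbU)
    (hn0 : 0 ≤ n) (hA0 : 0 ≤ A) (hC₁ : 0 ≤ C₁) (hFU0 : 0 ≤ FU) :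
    θ * Rc ≤ nU * FU * (C₁ * rbU) + BU := by
  have h1 : θ * Rc ≤ θ * V := mul_le_mul_of_nonneg_left hV hθ
  have hnU0 : 0 ≤ nU := hn0.trans hn
  have hrb' : C₁ * rb ≤ C₁ * rbU := mul_le_mul_of_nonneg_left hrb hC₁
  have hA' : A ≤ C₁ * rbU := hA.trans hrb'
  have hCrbU0 : 0 ≤ C₁ * rbU := hA0.trans hA'
  have hS' : S ≤ FU * (C₁ * rbU) :=
    hS.trans (mul_le_mul hF hA' hA0 hFU0)
  have hFA0 : 0 ≤ FU * (C₁ * rbU) := mul_nonneg hFU0 hCrbU0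
  have h2 : n * S ≤ nU * (FU * (C₁ * rbU)) := by
    calc n * S ≤ n * (FU * (C₁ * rbU)) := mul_le_mul_of_nonneg_left hS' hn0
      _ ≤ nU * (FU * (C₁ * rbU)) := mul_le_mul_of_nonneg_right hn hFA0
  calc θ * Rc ≤ θ * V := h1
    _ ≤ n * S + Bc := hFS
    _ ≤ nU * (FU * (C₁ * rbU)) + BU := add_le_add h2 (hBc.trans hBb)
    _ = nU * FU * (C₁ * rbU) + BU := by ring

/-- **The limit step**: a constant `0 ≤ θ` bounded by `K₁ R^{1/2-b} + K₂ R^{-δ}` for all `R ≥ 2`,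
with `b > 1/2` and `δ > 0`, vanishes. -/
theorem eq_zero_of_le_rpow {θ K₁ K₂ b δ : ℝ} (hθ : 0 ≤ θ) (hb : 1 / 2 < b) (hδ : 0 < δ)
    (h : ∀ R : ℕ, 2 ≤ R → θ ≤ K₁ * (R : ℝ) ^ ((1 : ℝ) / 2 - b) + K₂ * (R : ℝ) ^ (-δ)) :
    θ = 0 := by
  have t1 : Tendsto (fun x : ℝ => x ^ ((1 : ℝ) / 2 - b)) atTop (𝓝 0) := by
    have := tendsto_rpow_neg_atTop (show 0 < b - 1 / 2 by linarith)
    simpa only [neg_sub] using this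
  have t2 : Tendsto (fun x : ℝ => x ^ (-δ)) atTop (𝓝 0) := tendsto_rpow_neg_atTop hδ
  have t : Tendsto (fun R : ℕ => K₁ * (R : ℝ) ^ ((1 : ℝ) / 2 - b) + K₂ * (R : ℝ) ^ (-δ))
      atTop (𝓝 (K₁ * 0 + K₂ * 0)) :=
    ((t1.comp tendsto_natCast_atTop_atTop).const_mul K₁).add
      ((t2.comp tendsto_natCast_atTop_atTop).const_mul K₂)
  rw [mul_zero, mul_zero, add_zero] at t
  exact le_antisymm (ge_of_tendsto t (eventually_atTop.2 ⟨2, h⟩)) hθ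

end PercBoundarySqueezeAssembly

/-- **Route `PercBoundarySqueeze`, `Assembly`** (item stmt-CriticalPhenomena-6986):
`HalfSpaceOneArmRate → FreeBoxFatClusterMass → PercolationContinuityZ3`.
With `n = Nat.sqrt (R³)` in `FreeBoxSqueeze`, `BoundaryArmCount` and Q1 at `r = ⌊R/2⌋` bound the
exit term by `54·3^b·C₁·R^{7/2-b}`, Q2 bounds the fat-cluster term by `C₂ R^{3-δ}`, and
`|Λ_{⌊R/2⌋}| ≥ R³`; hence `0 ≤ θ(p_c) ≤ 54·3^b·C₁·R^{1/2-b} + C₂ R^{-δ} → 0` (Zhang 2000;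
Grimmett 1999, Thm 7.35 bookkeeping). -/
theorem percBoundarySqueeze_assembly_proof :
    Summit.CriticalPhenomena.PercolationContinuityZ3.Theses.PercBoundarySqueeze.Assembly := by
  unfold Assembly HalfSpaceOneArmRate FreeBoxFatClusterMass
  rintro ⟨b, C₁, hb, hQ1⟩ ⟨δ, C₂, hδ, hQ2⟩
  show theta (zdGraph 3) (0 : Site 3) (criticalProbI 3) = 0
  have hθ0 : 0 ≤ theta (zdGraph 3) (0 : Site 3) (criticalProbI 3) := measureReal_nonneg
  -- nonnegativity of the constant `C₁` (from the case `r = 1`)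
  have hC₁ : 0 ≤ C₁ := by
    have h := hQ1 1 le_rfl
    simp only [Nat.cast_one, Real.one_rpow, mul_one] at h
    exact measureReal_nonneg.trans h
  refine PercBoundarySqueezeAssembly.eq_zero_of_le_rpow (K₁ := 54 * (3 : ℝ) ^ b * C₁) (K₂ := C₂)
    hθ0 hb hδ ?_
  intro R hR2
  have hR1 : 1 ≤ R := le_trans one_le_two hR2
  have hRpos : (0 : ℝ) < R := Nat.cast_pos.2 (lt_of_lt_of_le zero_lt_two hR2)
  have hr1 : 1 ≤ R / 2 := by omega
  have hn1 : 1 ≤ Nat.sqrt (R ^ 3) := Nat.succ_le_of_lt (Nat.sqrt_pos.2 (pow_pos (by omega) 3))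
  -- the four inputs
  have hFS := freeBoxSqueeze_proof R (Nat.sqrt (R ^ 3)) hR1 hn1
  have hBAC := boundaryArmCount_proof R hR1
  have h1 := hQ1 (R / 2) hr1
  have h2 := hQ2 R hR1
  -- `|Λ_{⌊R/2⌋}| ≥ R³`
  have hcard : (R : ℝ) ^ 3 ≤ ((box 3 (R / 2)).card : ℝ) := by
    rw [Literature.Probability.LatticeModels.card_box]
    push_cast
    have hle : (R : ℝ) ≤ 2 * ((R / 2 : ℕ) : ℝ) + 1 := by
      have : R ≤ 2 * (R / 2) + 1 := by omega
      exact_mod_cast this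
    exact pow_le_pow_left₀ hRpos.le hle 3
  -- `n ≤ R^{3/2}`
  have hn_le : ((Nat.sqrt (R ^ 3) : ℕ) : ℝ) ≤ (R : ℝ) ^ ((3 : ℝ) / 2) := by
    have hsq : ((Nat.sqrt (R ^ 3) : ℕ) : ℝ) ^ 2 ≤ (R : ℝ) ^ 3 := by
      exact_mod_cast Nat.sqrt_le' (R ^ 3)
    calc ((Nat.sqrt (R ^ 3) : ℕ) : ℝ) = Real.sqrt (((Nat.sqrt (R ^ 3) : ℕ) : ℝ) ^ 2) :=
          (Real.sqrt_sq (Nat.cast_nonneg _)).symm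
      _ ≤ Real.sqrt ((R : ℝ) ^ 3) := Real.sqrt_le_sqrt hsq
      _ = (R : ℝ) ^ ((3 : ℝ) / 2) := by
          rw [Real.sqrt_eq_rpow, ← Real.rpow_natCast, ← Real.rpow_mul hRpos.le]
          norm_num
  -- `6(2R+1)² ≤ 54 R²`
  have hface : 6 * (2 * (R : ℝ) + 1) ^ 2 ≤ 54 * (R : ℝ) ^ 2 := by
    have h1R : (1 : ℝ) ≤ R := by exact_mod_cast hR1
    nlinarith
  -- `⌊R/2⌋^{-b} ≤ 3^b R^{-b}`
  have hhalf : ((R / 2 : ℕ) : ℝ) ^ (-b) ≤ (3 : ℝ) ^ b * (R : ℝ) ^ (-b) := by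
    have h3 : (R : ℝ) / 3 ≤ ((R / 2 : ℕ) : ℝ) := by
      have : R ≤ 3 * (R / 2) := by omega
      have : (R : ℝ) ≤ 3 * ((R / 2 : ℕ) : ℝ) := by exact_mod_cast this
      linarith
    calc ((R / 2 : ℕ) : ℝ) ^ (-b) ≤ ((R : ℝ) / 3) ^ (-b) :=
          Real.rpow_le_rpow_of_nonpos (by positivity) h3 (by linarith)
      _ = (3 : ℝ) ^ b * (R : ℝ) ^ (-b) := by
          rw [Real.div_rpow hRpos.le (by norm_num), Real.rpow_neg (by norm_num : (0 : ℝ) ≤ 3),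
            div_inv_eq_mul, mul_comm]
  -- chain everything
  have hmain : theta (zdGraph 3) (0 : Site 3) (criticalProbI 3) * (R : ℝ) ^ 3 ≤
      (R : ℝ) ^ ((3 : ℝ) / 2) * (54 * (R : ℝ) ^ 2) * (C₁ * ((3 : ℝ) ^ b * (R : ℝ) ^ (-b))) +
        C₂ * (R : ℝ) ^ ((3 : ℝ) - δ) :=
    PercBoundarySqueezeAssembly.chain hθ0 hcard hFS hBAC h1
      (Finset.sum_le_sum_of_subset_of_nonneg
        (Literature.Probability.LatticeModels.box_mono 3 (Nat.div_le_self R 2))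
        fun _ _ _ => measureReal_nonneg)
      h2 hn_le hface hhalf (Nat.cast_nonneg _) measureReal_nonneg hC₁
      (by positivity)
  have hmain' : theta (zdGraph 3) (0 : Site 3) (criticalProbI 3) * (R : ℝ) ^ 3 ≤
      (54 * (3 : ℝ) ^ b * C₁ * (R : ℝ) ^ ((1 : ℝ) / 2 - b) + C₂ * (R : ℝ) ^ (-δ)) *
        (R : ℝ) ^ 3 := by
    have e1 := PercBoundarySqueezeAssembly.rpow_bookkeeping hRpos b
    have e2 := PercBoundarySqueezeAssembly.rpow_three_sub hRpos δ
    calc _ ≤ _ := hmain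
      _ = _ := by rw [e2]; linear_combination (54 * (3 : ℝ) ^ b * C₁) * e1
  exact le_of_mul_le_mul_right hmain' (pow_pos hRpos 3)

end Summit.CriticalPhenomena.PercolationContinuityZ3.Theorems

end
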